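import Literature.NumberTheory.Rogawski1990.TransferFactsStabilisation
import Literature.NumberTheory.Rogawski1990.CMCharIdentityClauses
import HarnessLib

/-!
# The joint global transfer letter WITH Rogawski's CM character identities — `GlobalTransferWithCMCharIdentities` (RULING (V29) (J1))

Topic `NumberTheory/Rogawski1990`; namespace `Literature.NumberTheory.Rogawski1990`.  ONE NAMED FACT `def … : Prop` with body (a printed theorem bundle used as a
HYPOTHESIS by the engine; it REPLACES ★ ED. 4 `GlobalTransferWithStabilisationPackage` as the T1 antecedent — net head count unchanged, ED. 4 being its projection)
+ the projection theorem `.to_package`; no definition with data, no instance, no notation, no attribute, no `sorry`.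
Imports ★ `TransferFactsStabilisation` (ED. 5: the parametric carrier `GlobalTransferWithStabilisationPackageAnd Q` + `.to_package`) and ★ `CMCharIdentityClauses`
(P3b part B: `CMCharIdentityClauses`, `CMCharIdentityPackage` = `Q_CM`).  Cell pub/hodgecm-mathlib F0∕P3b (planner F0P3b-plan (g7), report-first), crux item
stmt-HodgeConjecture-24833 (H413); consumers: the Q-threaded T1 export (F0P3a, (J2)) and P3's `𝔠₀` (`hCM₀ := fun ξ … => (hQ ξ).nonsplit …`, (J3)).

WHY ONE JOINT LETTER (the Δ-twist caveat, sustained (V29)).  Every clause of ED. 4 is invariant under `Δ ↦ θ_H·Δ` for an automorphic character `θ` of `H` with `θ_∞ = 1`,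
while the identities [13.1.4] for `θΔ` are those for `Δ` with `ξ` replaced by `θ⁻¹ξ`; so «the identities hold at the chosen witness `Δ` of ED. 4» is not what print proves.
Print proves: for THE Langlands–Shelstad transfer factors (one global datum) transfer exists [Prop. 4.9.1], the fundamental lemma and the product formula hold [(4.3.3), §4.9],
the stabilisation package holds [§3.3, §5.4] AND the character identities hold at every finite place [Prop. 13.1.4; split places §4.13 (b), §12.2] — one existential.

HONEST LABEL: HC_CM is proved only modulo the printed citations until rung 0 closes; this letter is one of them (it subsumes ED. 4's).
-/

set_option autoImplicit false

noncomputable section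

open MeasureTheory NumberField IsDedekindDomain
open Literature.MeasureTheory.Group
open scoped MatrixGroups

namespace Literature.NumberTheory.Rogawski1990

open Literature.NumberTheory.Automorphic
open Literature.AlgebraicGeometry.ShimuraVarieties (unitaryGroup hermForm)
open Literature.NumberTheory.Automorphic.UnitaryGroup
open Literature.NumberTheory.Automorphic.UnitaryGroup.CotangentForms Literature.NumberTheory.GaloisRepresentations
open Literature.NumberTheory.Automorphic.Arthur2013.Leaves.TECR
open scoped Matrix ComplexOrder

section Joint

variable (L : Type) [Field L] [NumberField L] [IsCMField L] (H : Matrix (Fin 3) (Fin 3) L)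
  (hH : (H.map (cmConjRingHom L))ᵀ = H) (hHd : IsUnit H.det)

/-- **THE JOINT LETTER of RULING (V29) (J1)** — [Rogawski1990, Prop. 4.9.1 + (4.3.3) + §3.3 ∕ §5.4 + Prop. 13.1.4 at every finite place]: ★ ED. 5
`GlobalTransferWithStabilisationPackageAnd` at `Q := CMCharIdentityPackage L H hH hHd νH νG μω hμu` (★ `CMCharIdentityClauses`), under the Borel σ-algebras on the
orbit quotients exactly as ED. 4's body fixes them.  ONE existential over `(S_bad, Δ, m_H, m_G)`: local transfer data, fundamental lemma off `S_bad`, product formula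
with `Δ_∞`, per-class stabilisation package, AND Rogawski's CM character identities for every one-dimensional automorphic `ξ` of `H` at every finite place for
the SAME `Δ`.  This is the named fact the engine's T1 export is threaded by ((V29) (J2)); it REPLACES ED. 4 as the antecedent (head count unchanged: ED. 4 is its
projection `.to_package`).  [cite: Rogawski1990, Prop. 4.9.1 p. 55; (4.3.3) p. 44; §13.1 Prop. 13.1.4 p. 199; §12.2 p. 174] -/
def GlobalTransferWithCMCharIdentities
    (Δinf : ↥(UnitaryGroup.arch (↥(maximalRealSubfield L)) L (IsCMField.complexConj L) 2
          (Matrix.of fun i j : Fin 2 => if i.val + j.val + 1 = 2 then (1 : L) else 0)) ×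
        ↥(UnitaryGroup.arch (↥(maximalRealSubfield L)) L (IsCMField.complexConj L) 1
          (Matrix.of fun i j : Fin 1 => if i.val + j.val + 1 = 1 then (1 : L) else 0)) →
      ↥(UnitaryGroup.arch (↥(maximalRealSubfield L)) L (IsCMField.complexConj L) 3 H) → ℂ)
    [∀ v : HeightOneSpectrum (𝓞 ↥(maximalRealSubfield L)),
      MeasurableSpace ((cmDatum L 2 (Matrix.of fun i j : Fin 2 => if i.val + j.val + 1 = 2 then (1 : L) else 0)).Local v ×
        (cmDatum L 1 (Matrix.of fun i j : Fin 1 => if i.val + j.val + 1 = 1 then (1 : L) else 0)).Local v)]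
    [∀ v : HeightOneSpectrum (𝓞 ↥(maximalRealSubfield L)),
      BorelSpace ((cmDatum L 2 (Matrix.of fun i j : Fin 2 => if i.val + j.val + 1 = 2 then (1 : L) else 0)).Local v ×
        (cmDatum L 1 (Matrix.of fun i j : Fin 1 => if i.val + j.val + 1 = 1 then (1 : L) else 0)).Local v)]
    [∀ v : HeightOneSpectrum (𝓞 ↥(maximalRealSubfield L)), MeasurableSpace ((cmDatum L 3 H).Local v)]
    [∀ v : HeightOneSpectrum (𝓞 ↥(maximalRealSubfield L)), BorelSpace ((cmDatum L 3 H).Local v)]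
    (νH : ∀ v : HeightOneSpectrum (𝓞 ↥(maximalRealSubfield L)),
      Measure ((cmDatum L 2 (Matrix.of fun i j : Fin 2 => if i.val + j.val + 1 = 2 then (1 : L) else 0)).Local v ×
        (cmDatum L 1 (Matrix.of fun i j : Fin 1 => if i.val + j.val + 1 = 1 then (1 : L) else 0)).Local v))
    (νG : ∀ v : HeightOneSpectrum (𝓞 ↥(maximalRealSubfield L)), Measure ((cmDatum L 3 H).Local v))
    [∀ v, IsFiniteMeasureOnCompacts (νH v)] [∀ v, (νH v).IsMulRightInvariant]
    [∀ v, IsFiniteMeasureOnCompacts (νG v)] [∀ v, (νG v).IsMulRightInvariant]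
    (μω : HeckeCharacter L) (hμu : μω.IsUnitary) : Prop :=
  letI : ∀ (v : HeightOneSpectrum (𝓞 ↥(maximalRealSubfield L)))
      (a : ((cmDatum L 2 (Matrix.of fun i j : Fin 2 => if i.val + j.val + 1 = 2 then (1 : L) else 0)).Local v ×
        (cmDatum L 1 (Matrix.of fun i j : Fin 1 => if i.val + j.val + 1 = 1 then (1 : L) else 0)).Local v)),
      MeasurableSpace (((cmDatum L 2 (Matrix.of fun i j : Fin 2 => if i.val + j.val + 1 = 2 then (1 : L) else 0)).Local v ×
        (cmDatum L 1 (Matrix.of fun i j : Fin 1 => if i.val + j.val + 1 = 1 then (1 : L) else 0)).Local v) ⧸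
        Subgroup.centralizer ({a} : Set ((cmDatum L 2 (Matrix.of fun i j : Fin 2 => if i.val + j.val + 1 = 2 then (1 : L) else 0)).Local v ×
        (cmDatum L 1 (Matrix.of fun i j : Fin 1 => if i.val + j.val + 1 = 1 then (1 : L) else 0)).Local v))) :=
    fun _ _ => borel _
  letI : ∀ (v : HeightOneSpectrum (𝓞 ↥(maximalRealSubfield L))) (γ : (cmDatum L 3 H).Local v),
      MeasurableSpace ((cmDatum L 3 H).Local v ⧸ Subgroup.centralizer ({γ} : Set ((cmDatum L 3 H).Local v))) :=
    fun _ _ => borel _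
  GlobalTransferWithStabilisationPackageAnd L H Δinf νH νG (CMCharIdentityPackage L H hH hHd νH νG μω hμu)

/-- The joint letter projects onto ★ ED. 4 `GlobalTransferWithStabilisationPackage` (so every ED. 4 consumer is served by it).
[cite: Rogawski1990, §4.9 Prop. 4.9.1 (a), (b) p. 55; §4.3 (4.3.3) p. 44; §13.1 Prop. 13.1.4 p. 199] -/
theorem GlobalTransferWithCMCharIdentities.to_package
    {Δinf : ↥(UnitaryGroup.arch (↥(maximalRealSubfield L)) L (IsCMField.complexConj L) 2
          (Matrix.of fun i j : Fin 2 => if i.val + j.val + 1 = 2 then (1 : L) else 0)) ×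
        ↥(UnitaryGroup.arch (↥(maximalRealSubfield L)) L (IsCMField.complexConj L) 1
          (Matrix.of fun i j : Fin 1 => if i.val + j.val + 1 = 1 then (1 : L) else 0)) →
      ↥(UnitaryGroup.arch (↥(maximalRealSubfield L)) L (IsCMField.complexConj L) 3 H) → ℂ}
    [∀ v : HeightOneSpectrum (𝓞 ↥(maximalRealSubfield L)),
      MeasurableSpace ((cmDatum L 2 (Matrix.of fun i j : Fin 2 => if i.val + j.val + 1 = 2 then (1 : L) else 0)).Local v ×
        (cmDatum L 1 (Matrix.of fun i j : Fin 1 => if i.val + j.val + 1 = 1 then (1 : L) else 0)).Local v)]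
    [∀ v : HeightOneSpectrum (𝓞 ↥(maximalRealSubfield L)),
      BorelSpace ((cmDatum L 2 (Matrix.of fun i j : Fin 2 => if i.val + j.val + 1 = 2 then (1 : L) else 0)).Local v ×
        (cmDatum L 1 (Matrix.of fun i j : Fin 1 => if i.val + j.val + 1 = 1 then (1 : L) else 0)).Local v)]
    [∀ v : HeightOneSpectrum (𝓞 ↥(maximalRealSubfield L)), MeasurableSpace ((cmDatum L 3 H).Local v)]
    [∀ v : HeightOneSpectrum (𝓞 ↥(maximalRealSubfield L)), BorelSpace ((cmDatum L 3 H).Local v)]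
    {νH : ∀ v : HeightOneSpectrum (𝓞 ↥(maximalRealSubfield L)),
      Measure ((cmDatum L 2 (Matrix.of fun i j : Fin 2 => if i.val + j.val + 1 = 2 then (1 : L) else 0)).Local v ×
        (cmDatum L 1 (Matrix.of fun i j : Fin 1 => if i.val + j.val + 1 = 1 then (1 : L) else 0)).Local v)}
    {νG : ∀ v : HeightOneSpectrum (𝓞 ↥(maximalRealSubfield L)), Measure ((cmDatum L 3 H).Local v)}
    [∀ v, IsFiniteMeasureOnCompacts (νH v)] [∀ v, (νH v).IsMulRightInvariant]
    [∀ v, IsFiniteMeasureOnCompacts (νG v)] [∀ v, (νG v).IsMulRightInvariant]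
    {μω : HeckeCharacter L} {hμu : μω.IsUnitary}
    (h : GlobalTransferWithCMCharIdentities L H hH hHd Δinf νH νG μω hμu) :
    GlobalTransferWithStabilisationPackage L H Δinf νH νG :=
  GlobalTransferWithStabilisationPackageAnd.to_package h

end Joint

end Literature.NumberTheory.Rogawski1990

end
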